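import Literature.MathematicalPhysics.QuantumLattice.XYOrderGDProofs
import HarnessLib

/-!
# Reflection positivity of ground-state two-point functions (Kronecker-RP Hamiltonians)

Trunk T-QLATTICE; companion of `XYOrderGDProofs.lean` (`Matrix.kls_groundEnergy_reflection`,
ground-state reflection positivity *at the level of energies*). This file adds the statement
*at the level of correlation functions*, in the abstract Kronecker setting of
Kennedy–Lieb–Shastry, J. Stat. Phys. 53 (1988) 1019–1030, eqs. (20)–(25), and
Dyson–Lieb–Simon, J. Stat. Phys. 18 (1978) 335–383, §4 (Lemma 4.1, Theorem 4.2):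

* `Matrix.trace_posSemidef_conj_nonneg` — for positive semidefinite `c`, `d` and any `X`,
  `0 ≤ tr(c X d Xᴴ)` (spectral theorem; the algebraic core of reflection positivity of states
  given by positive matrices, DLS Lemma 4.1).
* `Matrix.exists_posSemidef_groundState` — a reflection-symmetric Kronecker Hamiltonian
  `K = A ⊗ 1 + 1 ⊗ A - Σᵢ Mᵢ ⊗ Mᵢ` (`Aᵀ = A`, `Mᵢ` real, `K` Hermitian) has a ground state
  `vec c` with `c` **positive semidefinite** (KLS eqs. (23)–(25): for a ground state `vec c` the
  two unit vectors `vec c_L`, `vec c_R`, `c_L = (ccᴴ)^{1/2}`, `c_R = (cᴴc)^{1/2}`, have average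
  energy `≤ E₀`, hence both are ground states; DLS Theorem 4.2 is the thermal version).
* `Matrix.posSemidef_kronecker_gram` — in the vector state `vec c` with `c ⪰ 0` the Gram matrix
  `G_{ij} = ⟨vec c, (X_j ⊗ X̄_i) vec c⟩ = tr(c X_j c X_iᴴ)` of "an observable on the left times the
  reflected observable on the right" is positive semidefinite (**reflection positivity of the
  state**, multi-point form); `Matrix.kronecker_conj_rayleigh_nonneg` is the one-observable case
  `0 ≤ ⟨vec c, (X ⊗ X̄) vec c⟩`.
* `Matrix.kronecker_conj_cauchySchwarz` — reflection Cauchy–Schwarz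
  `|⟨vec c, (X ⊗ Ȳ) vec c⟩|² ≤ ⟨vec c, (X ⊗ X̄) vec c⟩⟨vec c, (Y ⊗ Ȳ) vec c⟩`
  (`Matrix.normSq_apply_le_of_posSemidef_fin_two`).
* `Matrix.dotProduct_mulVec_eq_of_hasUniqueGroundState` — two unit ground-state vectors of a
  matrix with a non-degenerate ground state have the same expectations; hence
* `Matrix.groundState_reflectionPositive` / `Matrix.groundState_kronecker_conj_nonneg` /
  `Matrix.groundState_kronecker_real_nonneg` / `Matrix.groundState_reflection_cauchySchwarz` —
  **if the ground state of `K` is unique, EVERY unit ground-state vector `ψ` is reflection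
  positive**: `[⟨ψ, (X_j ⊗ X̄_i) ψ⟩]_{ij} ⪰ 0`, `0 ≤ ⟨ψ, (X ⊗ X̄) ψ⟩`, `0 ≤ ⟨ψ, (X ⊗ X) ψ⟩` for real
  `X`, and `|⟨ψ, (X ⊗ Ȳ) ψ⟩|² ≤ ⟨ψ, (X ⊗ X̄) ψ⟩⟨ψ, (Y ⊗ Ȳ) ψ⟩`.

Here `vec c = fun p : m × m => c p.1 p.2` identifies `ℂ^{m × m}` with `m × m` matrices
(`Matrix.kronecker_rayleigh`: `⟨vec c, (X ⊗ Y) vec c⟩ = tr(cᴴ X c Yᵀ)`), the left tensor factor is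
"the left half", the right factor "the reflected right half", and `X̄ = X.map star` is the entrywise
complex conjugate (`X̄ᵀ = Xᴴ`), which is the reflected copy `θX` of an observable `X` of the left
half in the DLS convention (for real matrices `X̄ = X`). In applications (XY / XXZ / Heisenberg
antiferromagnet after the KLS sublattice rotation, `xyRealFieldHamiltonian_eq_submatrix`,
`xyzRealFieldHamiltonian_eq_submatrix`) the ground state in the relevant sector is unique by
Perron–Frobenius, so the last four theorems apply to *the* ground state and give the usual
consequences (positive semidefiniteness of the reflected two-point kernel across every
reflection plane, reflection Cauchy–Schwarz, chessboard estimates at zero temperature).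
Related tree results: the THERMAL statement (Fröhlich–Israel–Lieb–Simon 1978 Thm 2.1, conjugate on
the first factor) is `FrohlichIsraelLiebSimon1978_thm21_matrix(_holds)`
(`TraceReflectionPositivity(Proofs).lean`); Lieb's spin-space version for the Hubbard model
(positive definite ground-state matrix) is `SpinReflection.exists_posDef_groundState_unique`.

## References

* [KLS1988JSP] T. Kennedy, E. H. Lieb, B. S. Shastry, *Existence of Néel order in some spin-½
  Heisenberg antiferromagnets*, J. Stat. Phys. 53 (1988) 1019–1030, eqs. (20)–(25).
* [DLS1978] F. J. Dyson, E. H. Lieb, B. Simon, *Phase transitions in quantum spin systems with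
  isotropic and nonisotropic interactions*, J. Stat. Phys. 18 (1978) 335–383, §4.
-/

noncomputable section

open Matrix Finset
open scoped ComplexOrder Kronecker

namespace Matrix

open Literature.MathematicalPhysics.QuantumLattice

variable {m : Type*} [Fintype m] [DecidableEq m]

/-! ### Positivity of `tr(c X d Xᴴ)` for positive semidefinite `c`, `d` -/

/-- A positive semidefinite complex matrix is unitarily diagonalisable with nonnegative real
eigenvalues: `c = U D_λ Uᴴ`, `UᴴU = UUᴴ = 1`, `λ ≥ 0` (Mathlib's spectral theorem, repackaged).
[folklore] -/
theorem PosSemidef.exists_unitary_diagonal {c : Matrix m m ℂ} (hc : c.PosSemidef) :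
    ∃ lam : m → ℝ, (∀ k, 0 ≤ lam k) ∧ ∃ U : Matrix m m ℂ, Uᴴ * U = 1 ∧ U * Uᴴ = 1 ∧
      c = U * diagonal (fun k => ((lam k : ℝ) : ℂ)) * Uᴴ := by
  refine ⟨hc.1.eigenvalues, fun k => hc.eigenvalues_nonneg k,
    (hc.1.eigenvectorUnitary : Matrix m m ℂ), ?_, ?_, ?_⟩
  · have h := Matrix.mem_unitaryGroup_iff'.1 hc.1.eigenvectorUnitary.2
    rwa [star_eq_conjTranspose] at h
  · have h := Matrix.mem_unitaryGroup_iff.1 hc.1.eigenvectorUnitary.2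
    rwa [star_eq_conjTranspose] at h
  · have h := hc.1.spectral_theorem
    rw [Unitary.conjStarAlgAut_apply, star_eq_conjTranspose] at h
    refine h.trans ?_
    congr 2

/-- **Positivity of the reflected pairing** (Dyson–Lieb–Simon, J. Stat. Phys. 18 (1978),
Lemma 4.1, finite-dimensional core): for positive semidefinite `c`, `d` and every `X`,
`tr(c X d Xᴴ) = Σ_{k,l} λ_k μ_l |(Uᴴ X V)_{kl}|² ≥ 0`, where `c = U D_λ Uᴴ`, `d = V D_μ Vᴴ`.
[cite: DLS1978, Lemma 4.1] -/
theorem trace_posSemidef_conj_nonneg {c d : Matrix m m ℂ} (hc : c.PosSemidef)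
    (hd : d.PosSemidef) (X : Matrix m m ℂ) : 0 ≤ trace (c * X * d * Xᴴ) := by
  obtain ⟨lam, hlam, U, hUU, -, hcU⟩ := hc.exists_unitary_diagonal
  obtain ⟨mu, hmu, V, -, hVV', hdV⟩ := hd.exists_unitary_diagonal
  obtain ⟨P, hP⟩ : ∃ P : Matrix m m ℂ, P = Uᴴ * X * V := ⟨_, rfl⟩
  have hPh : Pᴴ = Vᴴ * Xᴴ * U := by
    rw [hP, conjTranspose_mul, conjTranspose_mul, conjTranspose_conjTranspose, Matrix.mul_assoc]
  have key : trace (c * X * d * Xᴴ) =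
      ((∑ k, ∑ l, lam k * mu l * Complex.normSq (P k l) : ℝ) : ℂ) := by
    have e : c * X * d * Xᴴ =
        U * (diagonal (fun k => ((lam k : ℝ) : ℂ)) * (Uᴴ * X * V) *
          diagonal (fun k => ((mu k : ℝ) : ℂ)) * (Vᴴ * Xᴴ)) := by
      rw [hcU, hdV]
      simp only [Matrix.mul_assoc]
    rw [e, trace_mul_comm, ← hP,
      show diagonal (fun k => ((lam k : ℝ) : ℂ)) * P * diagonal (fun k => ((mu k : ℝ) : ℂ)) *
          (Vᴴ * Xᴴ) * U =
        diagonal (fun k => ((lam k : ℝ) : ℂ)) * P * diagonal (fun k => ((mu k : ℝ) : ℂ)) * Pᴴ by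
        rw [hPh]; simp only [Matrix.mul_assoc],
      trace_diagonal_mul_mul_diagonal_mul_conjTranspose]
    push_cast
    refine sum_congr rfl fun k _ => sum_congr rfl fun l _ => ?_
    rw [Complex.star_def, Complex.mul_conj]
  rw [key, Complex.zero_le_real]
  exact sum_nonneg fun k _ => sum_nonneg fun l _ =>
    mul_nonneg (mul_nonneg (hlam k) (hmu l)) (Complex.normSq_nonneg _)

/-! ### Reflection positivity of the vector state `vec c`, `c ⪰ 0` -/

omit [Fintype m] [DecidableEq m] in
/-- The entrywise conjugate, transposed, is the conjugate transpose: `(X̄)ᵀ = Xᴴ`. [folklore] -/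
theorem transpose_map_star (X : Matrix m m ℂ) : (X.map star)ᵀ = Xᴴ := rfl

omit [DecidableEq m] in
/-- `⟨vec c, (X ⊗ Ȳ) vec c⟩ = tr(c X c Yᴴ)` for Hermitian (in particular positive semidefinite) `c`
(Kennedy–Lieb–Shastry, J. Stat. Phys. 53 (1988), eq. (22), with the reflected observable written
as the entrywise conjugate `Ȳ = Y.map star`). [cite: KLS1988JSP, eq. (22)] -/
theorem kronecker_conj_rayleigh {c : Matrix m m ℂ} (hc : c.IsHermitian) (X Y : Matrix m m ℂ) :
    star (fun p : m × m => c p.1 p.2) ⬝ᵥ ((X ⊗ₖ Y.map star) *ᵥ fun p : m × m => c p.1 p.2) =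
      trace (c * X * c * Yᴴ) := by
  rw [kronecker_rayleigh, transpose_map_star, hc.eq]

/-- **Reflection positivity of a positive-matrix state, one observable** (DLS Lemma 4.1 / KLS
eqs. (22)–(25)): for `c ⪰ 0` and every `X`, `0 ≤ ⟨vec c, (X ⊗ X̄) vec c⟩ (= tr(c X c Xᴴ))`.
[cite: DLS1978, Lemma 4.1] -/
theorem kronecker_conj_rayleigh_nonneg {c : Matrix m m ℂ} (hc : c.PosSemidef) (X : Matrix m m ℂ) :
    0 ≤ star (fun p : m × m => c p.1 p.2) ⬝ᵥ ((X ⊗ₖ X.map star) *ᵥ fun p : m × m => c p.1 p.2) := by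
  rw [kronecker_conj_rayleigh hc.1]
  exact trace_posSemidef_conj_nonneg hc hc X

omit [DecidableEq m] in
/-- Sesquilinear expansion of the reflected pairing: for `Y = Σⱼ aⱼ Xⱼ`,
`tr(c Y d Yᴴ) = Σᵢ star aᵢ · Σⱼ tr(c Xⱼ d Xᵢᴴ) aⱼ`. [folklore] -/
theorem trace_conj_sum_smul {ι : Type*} [Fintype ι] (c d : Matrix m m ℂ) (a : ι → ℂ)
    (X : ι → Matrix m m ℂ) :
    trace (c * (∑ j, a j • X j) * d * (∑ i, a i • X i)ᴴ) =
      ∑ i, star (a i) * ∑ j, trace (c * X j * d * (X i)ᴴ) * a j := by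
  have h1 : c * (∑ j, a j • X j) * d = ∑ j, a j • (c * X j * d) := by
    rw [Finset.mul_sum, Finset.sum_mul]
    refine sum_congr rfl fun j _ => ?_
    rw [Matrix.mul_smul, Matrix.smul_mul]
  have h2 : (∑ i, a i • X i)ᴴ = ∑ i, star (a i) • (X i)ᴴ := by
    rw [conjTranspose_sum]
    exact sum_congr rfl fun i _ => conjTranspose_smul _ _
  rw [h1, h2, Finset.mul_sum, trace_sum]
  refine sum_congr rfl fun i _ => ?_
  rw [Finset.sum_mul, trace_sum, Finset.mul_sum]
  refine sum_congr rfl fun j _ => ?_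
  rw [Matrix.mul_smul, Matrix.smul_mul, trace_smul, trace_smul, smul_eq_mul, smul_eq_mul]
  ring

/-- **Reflection positivity of a positive-matrix state, Gram form** (DLS 1978 §4 / KLS 1988
eqs. (22)–(25)): for `c ⪰ 0` and observables `X₁, …, X_k`, the matrix
`G_{ij} = ⟨vec c, (X_j ⊗ X̄_i) vec c⟩ = tr(c X_j c X_iᴴ)` ("`θ(X_i) X_j`" expectations) is positive
semidefinite. [cite: DLS1978, Lemma 4.1] -/
theorem posSemidef_kronecker_gram {ι : Type*} [Fintype ι] {c : Matrix m m ℂ} (hc : c.PosSemidef)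
    (X : ι → Matrix m m ℂ) :
    (Matrix.of fun i j : ι => star (fun p : m × m => c p.1 p.2) ⬝ᵥ
        ((X j ⊗ₖ (X i).map star) *ᵥ fun p : m × m => c p.1 p.2)).PosSemidef := by
  have hG : (Matrix.of fun i j : ι => star (fun p : m × m => c p.1 p.2) ⬝ᵥ
      ((X j ⊗ₖ (X i).map star) *ᵥ fun p : m × m => c p.1 p.2)) =
        Matrix.of fun i j : ι => trace (c * X j * c * (X i)ᴴ) := by
    ext i j
    rw [of_apply, of_apply, kronecker_conj_rayleigh hc.1]
  rw [hG]
  refine PosSemidef.of_dotProduct_mulVec_nonneg ?_ fun a => ?_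
  · -- Hermitian: `star tr(c Xᵢ c Xⱼᴴ) = tr(Xⱼ c Xᵢᴴ c) = tr(c Xⱼ c Xᵢᴴ)`
    ext i j
    rw [conjTranspose_apply, of_apply, of_apply, ← trace_conjTranspose]
    simp only [conjTranspose_mul, conjTranspose_conjTranspose, hc.1.eq, ← Matrix.mul_assoc]
    rw [trace_mul_comm]
    simp only [← Matrix.mul_assoc]
  · -- the quadratic form is `tr(c Y c Yᴴ)`, `Y = Σ aⱼ Xⱼ`
    have h : star a ⬝ᵥ ((Matrix.of fun i j : ι => trace (c * X j * c * (X i)ᴴ)) *ᵥ a) =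
        trace (c * (∑ j, a j • X j) * c * (∑ i, a i • X i)ᴴ) := by
      rw [trace_conj_sum_smul]
      simp only [dotProduct, mulVec, of_apply, Pi.star_apply]
    rw [h]
    exact trace_posSemidef_conj_nonneg hc hc _


/-! ### Reflection Cauchy–Schwarz -/

/-- A positive semidefinite `2 × 2` complex matrix has `|G₀₁|² ≤ G₀₀ G₁₁` (its determinant is
nonnegative and its diagonal is real). [folklore] -/
theorem normSq_apply_le_of_posSemidef_fin_two {G : Matrix (Fin 2) (Fin 2) ℂ} (hG : G.PosSemidef) :
    Complex.normSq (G 0 1) ≤ (G 0 0).re * (G 1 1).re := by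
  have hdet := hG.det_nonneg
  rw [Matrix.det_fin_two] at hdet
  have h10 : G 1 0 = star (G 0 1) := (hG.1.apply 1 0).symm
  have h00 : G 0 0 = (((G 0 0).re : ℝ) : ℂ) := by
    obtain ⟨-, him⟩ := Complex.nonneg_iff.1 (hG.diag_nonneg (i := 0))
    exact Complex.ext (by simp) (by simpa using him.symm)
  have h11 : G 1 1 = (((G 1 1).re : ℝ) : ℂ) := by
    obtain ⟨-, him⟩ := Complex.nonneg_iff.1 (hG.diag_nonneg (i := 1))
    exact Complex.ext (by simp) (by simpa using him.symm)
  rw [h10, Complex.star_def, Complex.mul_conj, h00, h11, ← Complex.ofReal_mul,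
    ← Complex.ofReal_sub, Complex.zero_le_real] at hdet
  simpa using hdet

/-- **Reflection Cauchy–Schwarz in a positive-matrix state**: for `c ⪰ 0` and all `X`, `Y`,
`|⟨vec c, (X ⊗ Ȳ) vec c⟩|² ≤ ⟨vec c, (X ⊗ X̄) vec c⟩ · ⟨vec c, (Y ⊗ Ȳ) vec c⟩`
(Dyson–Lieb–Simon 1978, §4). [cite: DLS1978, Lemma 4.1] -/
theorem kronecker_conj_cauchySchwarz {c : Matrix m m ℂ} (hc : c.PosSemidef) (X Y : Matrix m m ℂ) :
    Complex.normSq (star (fun p : m × m => c p.1 p.2) ⬝ᵥ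
        ((X ⊗ₖ Y.map star) *ᵥ fun p : m × m => c p.1 p.2)) ≤
      (star (fun p : m × m => c p.1 p.2) ⬝ᵥ ((X ⊗ₖ X.map star) *ᵥ fun p : m × m => c p.1 p.2)).re *
        (star (fun p : m × m => c p.1 p.2) ⬝ᵥ
          ((Y ⊗ₖ Y.map star) *ᵥ fun p : m × m => c p.1 p.2)).re := by
  have h := normSq_apply_le_of_posSemidef_fin_two (posSemidef_kronecker_gram hc ![Y, X])
  simp only [of_apply, Matrix.cons_val_zero, Matrix.cons_val_one] at h
  rw [mul_comm]
  exact h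

/-! ### A positive semidefinite ground state (KLS eqs. (23)–(25)) -/

/-- **A reflection-symmetric Kronecker Hamiltonian has a positive semidefinite ground state**
(Kennedy–Lieb–Shastry, J. Stat. Phys. 53 (1988), eqs. (23)–(25); Dyson–Lieb–Simon, J. Stat.
Phys. 18 (1978), Theorem 4.2 for the thermal state): let `Aᵀ = A`, let the `Mᵢ` be real
(`Mᵢᵀ = Mᵢᴴ`) and let `K = A ⊗ 1 + 1 ⊗ A - Σᵢ Mᵢ ⊗ Mᵢ` be Hermitian. Then there is `c ⪰ 0` with
`‖vec c‖ = 1` and `vec c` in the ground space of `K`. (From any ground state `vec c₀`, the KLS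
trace inequality gives unit vectors `vec c_L`, `vec c_R` with `c_R = (c₀ᴴc₀)^{1/2} ⪰ 0` and
`½⟨K⟩_{c_L} + ½⟨K⟩_{c_R} ≤ ⟨K⟩_{c₀} = E₀`; by the variational principle both are `= E₀`.)
[cite: KLS1988JSP, eqs. (23)–(25)] -/
theorem exists_posSemidef_groundState [Nonempty m] {ι : Type*} [Fintype ι] (A : Matrix m m ℂ)
    (M : ι → Matrix m m ℂ) (hA : Aᵀ = A) (hMt : ∀ i, (M i)ᵀ = (M i)ᴴ)
    (hK : (A ⊗ₖ (1 : Matrix m m ℂ) + (1 : Matrix m m ℂ) ⊗ₖ A - ∑ i, M i ⊗ₖ M i).IsHermitian) :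
    ∃ c : Matrix m m ℂ, c.PosSemidef ∧
      star (fun p : m × m => c p.1 p.2) ⬝ᵥ (fun p : m × m => c p.1 p.2) = 1 ∧
      (fun p : m × m => c p.1 p.2) ∈
        (A ⊗ₖ (1 : Matrix m m ℂ) + (1 : Matrix m m ℂ) ⊗ₖ A - ∑ i, M i ⊗ₖ M i).groundSpace := by
  set K := A ⊗ₖ (1 : Matrix m m ℂ) + (1 : Matrix m m ℂ) ⊗ₖ A - ∑ i, M i ⊗ₖ M i with hKdef
  obtain ⟨ψ, hψ1, hψE⟩ := exists_groundState_unit hK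
  -- `ψ = vec c₀`
  set c₀ : Matrix m m ℂ := Matrix.of fun a b => ψ (a, b) with hc₀_def
  have hψc : (fun p : m × m => c₀ p.1 p.2) = ψ := by
    funext p; rfl
  have hc₀ : trace (c₀ᴴ * c₀) = 1 := by rw [← star_uncurry_dotProduct_uncurry, hψc, hψ1]
  obtain ⟨cL, cR, hLpsd, hRpsd, hLsq, hRsq, hineq⟩ := exists_kls_tracePair c₀
  have hL1 : trace (cLᴴ * cL) = 1 := by rw [hLpsd.1.eq, hLsq, trace_mul_comm, hc₀]
  have hR1 : trace (cRᴴ * cR) = 1 := by rw [hRpsd.1.eq, hRsq, hc₀]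
  have hL1' : star (fun p : m × m => cL p.1 p.2) ⬝ᵥ (fun p : m × m => cL p.1 p.2) = 1 := by
    rw [star_uncurry_dotProduct_uncurry, hL1]
  have hR1' : star (fun p : m × m => cR p.1 p.2) ⬝ᵥ (fun p : m × m => cR p.1 p.2) = 1 := by
    rw [star_uncurry_dotProduct_uncurry, hR1]
  -- the KLS inequality `½ R(c_L) + ½ R(c_R) ≤ R(c₀)` for `K = K(A, A, M, M)`
  have hRP : ((star (fun p : m × m => cL p.1 p.2) ⬝ᵥ (K *ᵥ fun p : m × m => cL p.1 p.2)).re +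
      (star (fun p : m × m => cR p.1 p.2) ⬝ᵥ (K *ᵥ fun p : m × m => cR p.1 p.2)).re) / 2 ≤
      (star (fun p : m × m => c₀ p.1 p.2) ⬝ᵥ (K *ᵥ fun p : m × m => c₀ p.1 p.2)).re := by
    rw [hKdef, kronecker_hamiltonian_rayleigh, kronecker_hamiltonian_rayleigh,
      kronecker_hamiltonian_rayleigh]
    simp only [hMt, hLpsd.1.eq, hRpsd.1.eq, hA, Complex.add_re, Complex.sub_re, Complex.re_sum]
    have t1 : trace (cL * A * cL) = trace (c₀ᴴ * A * c₀) := by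
      rw [trace_mul_cycle, hLsq, Matrix.mul_assoc, trace_mul_comm]
    have t2 : trace (cL * cL * A) = trace (c₀ᴴ * A * c₀) := by
      rw [hLsq, Matrix.mul_assoc, trace_mul_comm, Matrix.mul_assoc]
    have t3 : trace (cR * A * cR) = trace (c₀ᴴ * c₀ * A) := by
      rw [trace_mul_cycle, hRsq]
    have t4 : trace (cR * cR * A) = trace (c₀ᴴ * c₀ * A) := by
      rw [hRsq]
    rw [t1, t2, t3, t4]
    have hsum : 2 * (∑ i, (trace (c₀ᴴ * M i * c₀ * (M i)ᴴ)).re) ≤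
        ∑ i, (trace (cL * M i * cL * (M i)ᴴ)).re + ∑ i, (trace (cR * M i * cR * (M i)ᴴ)).re := by
      rw [mul_sum, ← sum_add_distrib]
      exact sum_le_sum fun i _ => by linarith [hineq (M i) (M i)]
    linarith [hsum]
  -- both halves are `≥ E₀`, the right-hand side is `= E₀`; hence `R(c_R) = E₀`
  rw [hψc, hψE] at hRP
  have hL := groundEnergy_le_rayleigh_holds hK (fun p : m × m => cL p.1 p.2) hL1'
  have hR := groundEnergy_le_rayleigh_holds hK (fun p : m × m => cR p.1 p.2) hR1'
  have hReq : (star (fun p : m × m => cR p.1 p.2) ⬝ᵥ (K *ᵥ fun p : m × m => cR p.1 p.2)).re =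
      K.groundEnergy := by linarith
  exact ⟨cR, hRpsd, hR1', (rayleigh_eq_groundEnergy_iff_holds hK _ hR1').1 hReq⟩

/-! ### Uniqueness: every ground-state vector is reflection positive -/

/-- **Expectations do not depend on the choice of a unit ground-state vector** when the ground
state is non-degenerate (`dim ker(A - E₀) = 1`: two unit vectors of a line differ by a phase).
Tasaki (2020) §2.1. [folklore] -/
theorem dotProduct_mulVec_eq_of_hasUniqueGroundState {n : Type*} [Fintype n] [DecidableEq n]
    {A : Matrix n n ℂ} (hA : A.HasUniqueGroundState) {φ ψ : n → ℂ} (hφ : φ ∈ A.groundSpace)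
    (hψ : ψ ∈ A.groundSpace) (hφ1 : star φ ⬝ᵥ φ = 1) (hψ1 : star ψ ⬝ᵥ ψ = 1)
    (O : Matrix n n ℂ) : star ψ ⬝ᵥ (O *ᵥ ψ) = star φ ⬝ᵥ (O *ᵥ φ) := by
  have hφ0 : (⟨φ, hφ⟩ : A.groundSpace) ≠ 0 := by
    intro h
    have h' : φ = 0 := by simpa using congrArg Subtype.val h
    rw [h', dotProduct_zero] at hφ1
    exact zero_ne_one hφ1
  have h1 : Module.finrank ℂ A.groundSpace = 1 := hA
  obtain ⟨a, ha⟩ := (finrank_eq_one_iff_of_nonzero' _ hφ0).1 h1 ⟨ψ, hψ⟩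
  have hψa : ψ = a • φ := by
    have := congrArg Subtype.val ha
    simpa using this.symm
  have haa : star a * a = 1 := by
    rw [hψa, star_smul, smul_dotProduct, dotProduct_smul, hφ1, smul_eq_mul, smul_eq_mul,
      mul_one] at hψ1
    exact hψ1
  rw [hψa, mulVec_smul, star_smul, smul_dotProduct, dotProduct_smul, smul_eq_mul, smul_eq_mul,
    ← mul_assoc, haa, one_mul]

/-- **Reflection positivity of the ground state, Gram form** (Dyson–Lieb–Simon 1978 §4 at zero
temperature; Kennedy–Lieb–Shastry 1988 eqs. (20)–(25)): let `K = A ⊗ 1 + 1 ⊗ A - Σᵢ Mᵢ ⊗ Mᵢ`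
be Hermitian with `Aᵀ = A`, `Mᵢ` real, and suppose the ground state of `K` is non-degenerate.
Then for every unit ground-state vector `ψ` and observables `X₁, …, X_k` of one half, the matrix
`[⟨ψ, (X_j ⊗ X̄_i) ψ⟩]_{ij}` (`= [⟨θ(X_i) X_j⟩]`) is positive semidefinite.
[cite: DLS1978, Theorem 4.2; KLS1988JSP, eqs. (20)–(25)] -/
theorem groundState_reflectionPositive [Nonempty m] {ι κ : Type*} [Fintype ι] [Fintype κ]
    (A : Matrix m m ℂ) (M : ι → Matrix m m ℂ) (hA : Aᵀ = A) (hMt : ∀ i, (M i)ᵀ = (M i)ᴴ)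
    (hK : (A ⊗ₖ (1 : Matrix m m ℂ) + (1 : Matrix m m ℂ) ⊗ₖ A - ∑ i, M i ⊗ₖ M i).IsHermitian)
    (hU : (A ⊗ₖ (1 : Matrix m m ℂ) + (1 : Matrix m m ℂ) ⊗ₖ A - ∑ i, M i ⊗ₖ M i).HasUniqueGroundState)
    {ψ : m × m → ℂ}
    (hψ : ψ ∈ (A ⊗ₖ (1 : Matrix m m ℂ) + (1 : Matrix m m ℂ) ⊗ₖ A - ∑ i, M i ⊗ₖ M i).groundSpace)
    (hψ1 : star ψ ⬝ᵥ ψ = 1) (X : κ → Matrix m m ℂ) :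
    (Matrix.of fun i j : κ => star ψ ⬝ᵥ ((X j ⊗ₖ (X i).map star) *ᵥ ψ)).PosSemidef := by
  obtain ⟨c, hc, hc1, hcmem⟩ := exists_posSemidef_groundState A M hA hMt hK
  have heq : (Matrix.of fun i j : κ => star ψ ⬝ᵥ ((X j ⊗ₖ (X i).map star) *ᵥ ψ)) =
      Matrix.of fun i j : κ => star (fun p : m × m => c p.1 p.2) ⬝ᵥ
        ((X j ⊗ₖ (X i).map star) *ᵥ fun p : m × m => c p.1 p.2) := by
    ext i j
    simp only [of_apply]
    exact dotProduct_mulVec_eq_of_hasUniqueGroundState hU hcmem hψ hc1 hψ1 _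
  rw [heq]
  exact posSemidef_kronecker_gram hc X

/-- **Reflection positivity of the ground state, one observable**: under the hypotheses of
`Matrix.groundState_reflectionPositive`, `0 ≤ ⟨ψ, (X ⊗ X̄) ψ⟩` for every unit ground-state
vector `ψ` and every `X` (a nonnegative real number). [cite: DLS1978, Theorem 4.2] -/
theorem groundState_kronecker_conj_nonneg [Nonempty m] {ι : Type*} [Fintype ι]
    (A : Matrix m m ℂ) (M : ι → Matrix m m ℂ) (hA : Aᵀ = A) (hMt : ∀ i, (M i)ᵀ = (M i)ᴴ)
    (hK : (A ⊗ₖ (1 : Matrix m m ℂ) + (1 : Matrix m m ℂ) ⊗ₖ A - ∑ i, M i ⊗ₖ M i).IsHermitian)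
    (hU : (A ⊗ₖ (1 : Matrix m m ℂ) + (1 : Matrix m m ℂ) ⊗ₖ A - ∑ i, M i ⊗ₖ M i).HasUniqueGroundState)
    {ψ : m × m → ℂ}
    (hψ : ψ ∈ (A ⊗ₖ (1 : Matrix m m ℂ) + (1 : Matrix m m ℂ) ⊗ₖ A - ∑ i, M i ⊗ₖ M i).groundSpace)
    (hψ1 : star ψ ⬝ᵥ ψ = 1) (X : Matrix m m ℂ) :
    0 ≤ star ψ ⬝ᵥ ((X ⊗ₖ X.map star) *ᵥ ψ) := by
  obtain ⟨c, hc, hc1, hcmem⟩ := exists_posSemidef_groundState A M hA hMt hK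
  rw [dotProduct_mulVec_eq_of_hasUniqueGroundState hU hcmem hψ hc1 hψ1]
  exact kronecker_conj_rayleigh_nonneg hc X

/-- **Reflection Cauchy–Schwarz for the ground state**: under the hypotheses of
`Matrix.groundState_reflectionPositive`, for every unit ground-state vector `ψ` and all `X`, `Y`,
`|⟨ψ, (X ⊗ Ȳ) ψ⟩|² ≤ ⟨ψ, (X ⊗ X̄) ψ⟩ · ⟨ψ, (Y ⊗ Ȳ) ψ⟩` ("reflection domination" of ground-state
two-point functions). [cite: DLS1978, Theorem 4.2] -/
theorem groundState_reflection_cauchySchwarz [Nonempty m] {ι : Type*} [Fintype ι]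
    (A : Matrix m m ℂ) (M : ι → Matrix m m ℂ) (hA : Aᵀ = A) (hMt : ∀ i, (M i)ᵀ = (M i)ᴴ)
    (hK : (A ⊗ₖ (1 : Matrix m m ℂ) + (1 : Matrix m m ℂ) ⊗ₖ A - ∑ i, M i ⊗ₖ M i).IsHermitian)
    (hU : (A ⊗ₖ (1 : Matrix m m ℂ) + (1 : Matrix m m ℂ) ⊗ₖ A - ∑ i, M i ⊗ₖ M i).HasUniqueGroundState)
    {ψ : m × m → ℂ}
    (hψ : ψ ∈ (A ⊗ₖ (1 : Matrix m m ℂ) + (1 : Matrix m m ℂ) ⊗ₖ A - ∑ i, M i ⊗ₖ M i).groundSpace)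
    (hψ1 : star ψ ⬝ᵥ ψ = 1) (X Y : Matrix m m ℂ) :
    Complex.normSq (star ψ ⬝ᵥ ((X ⊗ₖ Y.map star) *ᵥ ψ)) ≤
      (star ψ ⬝ᵥ ((X ⊗ₖ X.map star) *ᵥ ψ)).re * (star ψ ⬝ᵥ ((Y ⊗ₖ Y.map star) *ᵥ ψ)).re := by
  have h := normSq_apply_le_of_posSemidef_fin_two
    (groundState_reflectionPositive A M hA hMt hK hU hψ hψ1 ![Y, X])
  simp only [of_apply, Matrix.cons_val_zero, Matrix.cons_val_one] at h
  rw [mul_comm]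
  exact h

/-- **Reflection positivity of the ground state, real observable**: under the hypotheses of
`Matrix.groundState_reflectionPositive`, for a REAL matrix `X` (`Xᵀ = Xᴴ`, e.g. products of
`S⁺`, `S⁻`, `S³`, `S¹`, `iS²` on sites of the left half) and every unit ground-state vector `ψ`,
`0 ≤ re ⟨ψ, (X ⊗ X) ψ⟩` and `im ⟨ψ, (X ⊗ X) ψ⟩ = 0`. [cite: DLS1978, Theorem 4.2] -/
theorem groundState_kronecker_real_nonneg [Nonempty m] {ι : Type*} [Fintype ι]
    (A : Matrix m m ℂ) (M : ι → Matrix m m ℂ) (hA : Aᵀ = A) (hMt : ∀ i, (M i)ᵀ = (M i)ᴴ)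
    (hK : (A ⊗ₖ (1 : Matrix m m ℂ) + (1 : Matrix m m ℂ) ⊗ₖ A - ∑ i, M i ⊗ₖ M i).IsHermitian)
    (hU : (A ⊗ₖ (1 : Matrix m m ℂ) + (1 : Matrix m m ℂ) ⊗ₖ A - ∑ i, M i ⊗ₖ M i).HasUniqueGroundState)
    {ψ : m × m → ℂ}
    (hψ : ψ ∈ (A ⊗ₖ (1 : Matrix m m ℂ) + (1 : Matrix m m ℂ) ⊗ₖ A - ∑ i, M i ⊗ₖ M i).groundSpace)
    (hψ1 : star ψ ⬝ᵥ ψ = 1) {X : Matrix m m ℂ} (hX : Xᵀ = Xᴴ) :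
    0 ≤ (star ψ ⬝ᵥ ((X ⊗ₖ X) *ᵥ ψ)).re ∧ (star ψ ⬝ᵥ ((X ⊗ₖ X) *ᵥ ψ)).im = 0 := by
  have hXr : X.map star = X := by
    have h : (X.map star)ᵀ = Xᵀ := by rw [transpose_map_star, hX]
    exact transpose_injective h
  have h := groundState_kronecker_conj_nonneg A M hA hMt hK hU hψ hψ1 X
  rw [hXr] at h
  obtain ⟨h1, h2⟩ := Complex.nonneg_iff.1 h
  exact ⟨h1, h2.symm⟩

end Matrix

end
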